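import Summits.QuantumFields.YangMills.Theorems.UnitScaleTiltProp7ClosedFibreMinimiser
import Summits.QuantumFields.YangMills.Theorems.UnitScaleTiltProp7FlatRigidity
import Literature.MathematicalPhysics.QuantumFieldTheory.Balaban1983to89.T3ExistSplit
import HarnessLib

/-!
# Route `UnitScaleTilt`, crux K1 «MinimiserStabilityRegPr» (stmt-QuantumFields-19200) — companions of `UnitScaleTiltProp7ClosedFibreMinimiser`:
# (§1) the CHEAPEST SUB-CASE, in Lean, of its §4 interiority sentence — **at the FLAT datum `V ≡ 1` every minimiser of the Wilson action over print's
# CLOSED regular fibre is flat, hence lies in the OPEN regular space `𝔘_k(e)` for every `e > 0`**; (§2) two more SOCKETS on the same spine — the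
# existence half with the supplier-friendly conclusion «`RegPr e′` for SOME `e′ < e`», and the located attainment node `T3ExistSplit.MinSixAttainedAt`
# (ATT, consumed by `Prop7PV3CDEAttainment.prop7From14At_v8_of_A_C_att`) ⇐ «closed fibre non-empty» ∧ «closed-fibre minimisers interior»

Cell `ym3-torus` (HUMAN RULING D-0037, YM ladder rung R3), width seat `ym-ust-20520-w4` (g0); OWNER W-SEAT MAP pass #2, item (3) «+ its cheapest in-Lean
sub-case».  THEOREMS ONLY (0 `def`, 0 `sorry`, standard axioms); nothing imported is modified.

The sibling re-points the existence half of [Balaban1985Variational] Prop. 7 (from a background (14), `T3Thm1CarrierNative.Prop7From14NativeAt`) onto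
ONE displayed ∀-sentence: «closed-fibre minimisers over (7)-data with a (14)-background lie in the open class `𝔘_k(e)`».  Here that sentence is
PROVED at the flat datum: over `V ≡ 1` (background `U₀ ≡ 1 ∈ 𝔘_k(e₀) ∩ 𝔅_k(1)`, `e₀ > 0`) a minimiser `Ū` of (5) over the closed fibre `(6̄)(e₀) ∩ 𝔅_k(1)`
has `A(Ū) ≤ A(1) = 0`, hence every plaquette variable of `Ū` is `1` (`Re tr g = 1 ⇒ g = 1` on `SU(2)`: p1's `Prop7FlatDatum.plaqHol_eq_one_of_wilsonAction4_eq_zero`),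
hence `Ū ∈ 𝔘_k(e)` for EVERY `e > 0` (p1's `Prop7FlatRigidity.regPr_of_plaqHol_eq_one`: `|1 − 1| = 0` and the covariant divergence (1.2) of a trivial
plaquette field vanishes) — so §3 of the sibling makes it a minimiser over print's OPEN space (6)(e₀) and R2-critical.  Twin at NODE 00's objects:
`BalabanUVNodesN07AvoidanceAtFlatData`.

§2: `existenceMinimalOrbit_of_interior'` (hypothesis concludes `∃ e′ < e, Ū ∈ 𝔘_k(e′)`, e.g. print's halved radius; `regPr_mono`) and
`minSixAttainedAt_of_nonempty_of_interior` (for `2a₀` admissible: NONEMPTY «for (7)-data, `(6̄)(ε₀) ∩ 𝔅_k(V) ≠ ∅` on the shell `B₃ε₁ ≤ ε₀ ≤ a₀`» —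
print's (11)–(13) p.279–280, Thm 1 one level down — and INTERIOR «its minimisers lie in `𝔘_k(ε₀)`» ⇒ `MinSixAttainedAt L a₀ a₁ B₃`).

HONEST FRAMING.  A non-vacuity instance (the flat sector) and two by-name reductions; nothing of [Balaban1985Variational] asserted; no stub ∕ crux ∕ count moves; YM₃ on T³ is
ladder rung R3 — not d = 4, not a mass gap, not Clay.

References: T. Bałaban, CMP **102** (1985) 277–309 [Balaban1985Variational] ((2), (5)–(6) p.278, Prop. 7 p.299); CMP **99** (1985) 75–102
[Balaban1985RegularSpaces] ((1.1)–(1.2) p.76); CMP **109** (1987) 249–301 [Balaban1987RG1] ((0.2) p.252).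
-/

set_option autoImplicit false

noncomputable section

namespace Summit.QuantumFields.YangMills.Theorems.Prop7ClosedFibreMinimiser

open Set
open scoped Matrix.Norms.L2Operator
open Literature.MathematicalPhysics.QuantumFieldTheory.Balaban1983to89
open Literature.MathematicalPhysics.QuantumFieldTheory.Balaban1983to89.T3ContinuumYM3Torus
open Literature.MathematicalPhysics.QuantumFieldTheory.Balaban1983to89.T3UnitLawDensityEML (ℰp)
open Literature.MathematicalPhysics.QuantumFieldTheory.Balaban1983to89.T3PrintedRegularMinimiser (RegPr regFibrePr regPr_one)
open Literature.MathematicalPhysics.QuantumFieldTheory.Balaban1983to89.T3RegularMinimiser (regThreshold)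
open Literature.MathematicalPhysics.QuantumFieldTheory.Balaban1983to89.T3TiltDescent (descendTo)
open Literature.MathematicalPhysics.QuantumFieldTheory.Balaban1983to89.T3ConstrainedMinimiser (fibre)
open Literature.MathematicalPhysics.QuantumFieldTheory.Balaban1983to89.T3DescentFibreTower (one_mem_fibre_one expMeanLogSU_E_one)
open Literature.MathematicalPhysics.QuantumFieldTheory.Balaban1983to89.T3Thm1CarrierNative (IsCritR2 isCritR2_of_isMinOn wilsonAction4_one_eq_zero)
open Literature.MathematicalPhysics.QuantumFieldTheory.Balaban1983to89.B10Eq27TorusAxialLog (toUField unitsField)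
open Literature.MathematicalPhysics.QuantumFieldTheory.Balaban1983to89.B10Eq68TorusRegularity (covDivT)
open Summit.QuantumFields.YangMills.Theorems.Prop7FlatDatum (plaqHol_eq_one_of_wilsonAction4_eq_zero)
open Summit.QuantumFields.YangMills.Theorems.Prop7FlatRigidity (regPr_of_plaqHol_eq_one)
open Literature.MathematicalPhysics.QuantumFieldTheory.Balaban1983to89.T3PrintedMinimiserExistence (regPr_mono)
open Literature.MathematicalPhysics.QuantumFieldTheory.Balaban1983to89.T3ExistSplit (MinSixAttainedAt)
open Literature.MathematicalPhysics.QuantumFieldTheory.Balaban1983to89.ExpMeanLog (deltaSU)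

/-! ## The flat datum: the interiority sentence holds at every radius -/

section Flat

variable (F : T3Family) {n K : ℕ} (h : n ≤ K)

/-- ★ **THE INTERIORITY SENTENCE HOLDS OUTRIGHT AT THE FLAT DATUM.**  Over `V ≡ 1` (with the flat background `U₀ ≡ 1 ∈ 𝔘_k(e₀) ∩ 𝔅_k(1)`, `e₀ > 0`),
every minimiser `Ū` of the Wilson action over the closed fibre `(6̄)(e₀) ∩ 𝔅_k(1)` has `A(Ū) ≤ A(1) = 0`, hence is FLAT (every plaquette variable `1`:
`Re tr g = 1 ⇒ g = 1` on `SU(2)`, `Prop7FlatDatum.plaqHol_eq_one_of_wilsonAction4_eq_zero`), hence lies in the open class `𝔘_k(e)` for EVERY `e > 0`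
(`Prop7FlatRigidity.regPr_of_plaqHol_eq_one`: `|1 − 1| = 0`, and the covariant divergence (1.2) of a trivial plaquette field vanishes) — the cheapest
instance of §4's hypothesis, in Lean (twin of NODE 00's `BalabanUVNodesN07AvoidanceAtFlatData`). [cite: Balaban1985Variational, (2), (5)–(6) p.278, Prop. 7 p.299] -/
theorem closedFibreInterior_at_flat_datum {e₀ e : ℝ} (he₀ : 0 < e₀) (he : 0 < e)
    {Ū : GaugeField (F.P K) 0 (Matrix.specialUnitaryGroup (Fin 2) ℂ)}
    (hmin : IsMinOn (fun W : GaugeField (F.P K) 0 (Matrix.specialUnitaryGroup (Fin 2) ℂ) => wilsonAction4 W)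
        ({U : GaugeField (F.P K) 0 (Matrix.specialUnitaryGroup (Fin 2) ℂ) | ∀ p : Plaq (F.P K) 0,
            GaugeGroup.dist1 (GaugeField.plaqHol U p) ≤ regThreshold F n K e₀} ∩
          descendTo F ℰp n K h ⁻¹' {(1 : GaugeField (F.P n) 0 (Matrix.specialUnitaryGroup (Fin 2) ℂ))} ∩
          {U | ∀ b : PBond (F.P K) 0, ‖covDivT 1 (unitsField (toUField U)) b.dir b.src‖ ≤ e₀ * ((F.L : ℝ)⁻¹) ^ (3 * (K - n))}) Ū) :
    (∀ p : Plaq (F.P K) 0, GaugeField.plaqHol Ū p = 1) ∧ RegPr F n K e Ū := by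
  have h1 := background_mem_closedRegFibre F h le_rfl (regPr_one he₀) (one_mem_fibre_one F ℰp expMeanLogSU_E_one h)
  have hA0 : wilsonAction4 Ū = 0 :=
    le_antisymm ((hmin h1).trans_eq (wilsonAction4_one_eq_zero (F := F) (K := K))) (wilsonAction4_nonneg Ū)
  have hflat := plaqHol_eq_one_of_wilsonAction4_eq_zero Ū hA0
  exact ⟨hflat, regPr_of_plaqHol_eq_one F he hflat⟩

/-- Hence, at the flat datum, §2's closed-fibre minimiser IS a minimiser over print's OPEN space (6)(e₀) and is R2-critical — the existence clause
of Prop. 7 at `V ≡ 1` by the direct method alone (of course also witnessed by `U ≡ 1` itself; the point is that §4's scheme closes here without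
any a-priori estimate). [cite: Balaban1985Variational, Prop. 7 p.299] -/
theorem isMinOn_regFibrePr_at_flat_datum {e₀ : ℝ} (he₀ : 0 < e₀)
    {Ū : GaugeField (F.P K) 0 (Matrix.specialUnitaryGroup (Fin 2) ℂ)}
    (hŪ : Ū ∈ {U : GaugeField (F.P K) 0 (Matrix.specialUnitaryGroup (Fin 2) ℂ) | ∀ p : Plaq (F.P K) 0,
            GaugeGroup.dist1 (GaugeField.plaqHol U p) ≤ regThreshold F n K e₀} ∩
          descendTo F ℰp n K h ⁻¹' {(1 : GaugeField (F.P n) 0 (Matrix.specialUnitaryGroup (Fin 2) ℂ))} ∩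
          {U | ∀ b : PBond (F.P K) 0, ‖covDivT 1 (unitsField (toUField U)) b.dir b.src‖ ≤ e₀ * ((F.L : ℝ)⁻¹) ^ (3 * (K - n))})
    (hmin : IsMinOn (fun W : GaugeField (F.P K) 0 (Matrix.specialUnitaryGroup (Fin 2) ℂ) => wilsonAction4 W)
        ({U : GaugeField (F.P K) 0 (Matrix.specialUnitaryGroup (Fin 2) ℂ) | ∀ p : Plaq (F.P K) 0,
            GaugeGroup.dist1 (GaugeField.plaqHol U p) ≤ regThreshold F n K e₀} ∩
          descendTo F ℰp n K h ⁻¹' {(1 : GaugeField (F.P n) 0 (Matrix.specialUnitaryGroup (Fin 2) ℂ))} ∩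
          {U | ∀ b : PBond (F.P K) 0, ‖covDivT 1 (unitsField (toUField U)) b.dir b.src‖ ≤ e₀ * ((F.L : ℝ)⁻¹) ^ (3 * (K - n))}) Ū) :
    Ū ∈ regFibrePr F n K h e₀ 1 ∧
      IsMinOn (fun W : GaugeField (F.P K) 0 (Matrix.specialUnitaryGroup (Fin 2) ℂ) => wilsonAction4 W) (regFibrePr F n K h e₀ 1) Ū ∧
      IsCritR2 F n K h 1 Ū := by
  have hint := (closedFibreInterior_at_flat_datum F h he₀ he₀ hmin).2
  have hm := isMinOn_regFibrePr_of_interior F h hmin hŪ.1.2 hint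
  exact ⟨hm.1, hm.2, isCritR2_of_isMinOn he₀ hm.1 hm.2⟩

end Flat

/-! ## Two more sockets on the same spine -/

section Sockets

/-- **THE EXISTENCE HALF ⇐ INTERIORITY WITH A SHRUNK RADIUS** (supplier-friendly variant of the sibling's `existenceMinimalOrbit_of_interior`): it is
enough that every closed-fibre minimiser at radius `e = O₁L³B₃ε₁` lies in `𝔘_k(e′)` for SOME `e′ < e` (print's halved radius `max{B₃ε₁, ½e}` of
Sect. F, say) — `𝔘_k(e′) ⊆ 𝔘_k(e)`. [cite: Balaban1985Variational, Prop. 7 p.299, Sect. F p.304] -/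
theorem existenceMinimalOrbit_of_interior' (F : T3Family) {B₃ O₁ a₁' : ℝ} (hB₃ : 0 < B₃) (hO₁ : 1 ≤ O₁)
    (hA3 : (143 * ((((3 + 4 : ℕ) : ℝ)) ^ 2 / 4) ^ 2) * (2 * (O₁ * (F.L : ℝ) ^ 3 * B₃ * a₁')) ≤ 1 / 3)
    (hA2 : 2 * (2 * (O₁ * (F.L : ℝ) ^ 3 * B₃ * a₁')) ≤ 2 * deltaSU (Fin 2) / (((3 + 4) * F.L : ℕ) : ℝ) ^ 2)
    (hInt : ∀ (n K : ℕ) (hnK : n < K) (ε₁ : ℝ), 0 < ε₁ → ε₁ ≤ a₁' →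
      ∀ V : GaugeField (F.P n) 0 (Matrix.specialUnitaryGroup (Fin 2) ℂ), PlaqSmall ε₁ V →
        ∀ U₀ : GaugeField (F.P K) 0 (Matrix.specialUnitaryGroup (Fin 2) ℂ), RegPr F n K ((F.L : ℝ) ^ 3 * B₃ * ε₁) U₀ →
          U₀ ∈ fibre F ℰp n K hnK.le V →
          ∀ Ū : GaugeField (F.P K) 0 (Matrix.specialUnitaryGroup (Fin 2) ℂ),
            Ū ∈ {U : GaugeField (F.P K) 0 (Matrix.specialUnitaryGroup (Fin 2) ℂ) | ∀ p : Plaq (F.P K) 0,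
                  GaugeGroup.dist1 (GaugeField.plaqHol U p) ≤ regThreshold F n K (O₁ * (F.L : ℝ) ^ 3 * B₃ * ε₁)} ∩
                descendTo F ℰp n K hnK.le ⁻¹' {V} ∩
                {U | ∀ b : PBond (F.P K) 0, ‖covDivT 1 (unitsField (toUField U)) b.dir b.src‖ ≤
                  (O₁ * (F.L : ℝ) ^ 3 * B₃ * ε₁) * ((F.L : ℝ)⁻¹) ^ (3 * (K - n))} →
            IsMinOn (fun W : GaugeField (F.P K) 0 (Matrix.specialUnitaryGroup (Fin 2) ℂ) => wilsonAction4 W)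
              ({U : GaugeField (F.P K) 0 (Matrix.specialUnitaryGroup (Fin 2) ℂ) | ∀ p : Plaq (F.P K) 0,
                  GaugeGroup.dist1 (GaugeField.plaqHol U p) ≤ regThreshold F n K (O₁ * (F.L : ℝ) ^ 3 * B₃ * ε₁)} ∩
                descendTo F ℰp n K hnK.le ⁻¹' {V} ∩
                {U | ∀ b : PBond (F.P K) 0, ‖covDivT 1 (unitsField (toUField U)) b.dir b.src‖ ≤
                  (O₁ * (F.L : ℝ) ^ 3 * B₃ * ε₁) * ((F.L : ℝ)⁻¹) ^ (3 * (K - n))}) Ū →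
            ∃ e' : ℝ, e' < O₁ * (F.L : ℝ) ^ 3 * B₃ * ε₁ ∧ RegPr F n K e' Ū)
    (n K : ℕ) (hnK : n < K) (ε₁ : ℝ) (hε₁ : 0 < ε₁)
    (V : GaugeField (F.P n) 0 (Matrix.specialUnitaryGroup (Fin 2) ℂ)) (hV : PlaqSmall ε₁ V)
    (U₀ : GaugeField (F.P K) 0 (Matrix.specialUnitaryGroup (Fin 2) ℂ)) (hreg : RegPr F n K ((F.L : ℝ) ^ 3 * B₃ * ε₁) U₀)
    (hfib : U₀ ∈ fibre F ℰp n K hnK.le V) (hε₁a : ε₁ ≤ a₁') :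
    ∃ U ∈ regFibrePr F n K hnK.le (O₁ * (F.L : ℝ) ^ 3 * B₃ * ε₁) V,
      IsMinOn (fun W : GaugeField (F.P K) 0 (Matrix.specialUnitaryGroup (Fin 2) ℂ) => wilsonAction4 W)
        (regFibrePr F n K hnK.le (O₁ * (F.L : ℝ) ^ 3 * B₃ * ε₁) V) U :=
  existenceMinimalOrbit_of_interior F hB₃ hO₁ hA3 hA2
    (fun n K hnK ε₁ hε₁ hε₁a V hV U₀ hreg hfib Ū hŪ hmin => by
      obtain ⟨e', he', hŪ'⟩ := hInt n K hnK ε₁ hε₁ hε₁a V hV U₀ hreg hfib Ū hŪ hmin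
      exact regPr_mono F he'.le hŪ')
    n K hnK ε₁ hε₁ V hV U₀ hreg hfib hε₁a

/-- ★ **THE LOCATED ATTAINMENT NODE (ATT) ⇐ «CLOSED FIBRE NON-EMPTY» ∧ «CLOSED-FIBRE MINIMISERS INTERIOR».**  For `2a₀` admissible as in
[Balaban1985Averaging] (53) at block size `L`: if on the shell `0 < ε₁ ≤ a₁`, `B₃ε₁ ≤ ε₀ ≤ a₀` every (7)-datum `V` has a NON-EMPTY closed fibre
`(6̄)(ε₀) ∩ 𝔅_k(V)` (print: the minimiser one level down, (11)–(13) pp.279–280) and every minimiser of (5) over it lies in `𝔘_k(ε₀)`, then the infimum of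
the Wilson action over print's OPEN space (6)(ε₀) is ATTAINED — `T3ExistSplit.MinSixAttainedAt L a₀ a₁ B₃`, the node consumed by
`Prop7PV3CDEAttainment.prop7From14At_v8_of_A_C_att` (V3 ⇐ rows A ∧ C ∧ ATT). [cite: Balaban1985Variational, Prop. 7 p.299, (11)–(13) pp.279–280] -/
theorem minSixAttainedAt_of_nonempty_of_interior {L : ℕ} {a₀ a₁ B₃ : ℝ} (ha₀ : 0 < a₀)
    (hA3 : (143 * ((((3 + 4 : ℕ) : ℝ)) ^ 2 / 4) ^ 2) * (2 * a₀) ≤ 1 / 3)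
    (hA2 : 2 * (2 * a₀) ≤ 2 * deltaSU (Fin 2) / (((3 + 4) * L : ℕ) : ℝ) ^ 2)
    (hne : ∀ F : T3Family, F.L = L → ∀ (n K : ℕ) (hnK : n < K) (ε₁ ε₀ : ℝ), 0 < ε₁ → ε₁ ≤ a₁ → B₃ * ε₁ ≤ ε₀ → ε₀ ≤ a₀ →
      ∀ V : GaugeField (F.P n) 0 (Matrix.specialUnitaryGroup (Fin 2) ℂ), PlaqSmall ε₁ V →
        ({U : GaugeField (F.P K) 0 (Matrix.specialUnitaryGroup (Fin 2) ℂ) | ∀ p : Plaq (F.P K) 0,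
              GaugeGroup.dist1 (GaugeField.plaqHol U p) ≤ regThreshold F n K ε₀} ∩ descendTo F ℰp n K hnK.le ⁻¹' {V} ∩
          {U | ∀ b : PBond (F.P K) 0, ‖covDivT 1 (unitsField (toUField U)) b.dir b.src‖ ≤ ε₀ * ((F.L : ℝ)⁻¹) ^ (3 * (K - n))}).Nonempty)
    (hint : ∀ F : T3Family, F.L = L → ∀ (n K : ℕ) (hnK : n < K) (ε₁ ε₀ : ℝ), 0 < ε₁ → ε₁ ≤ a₁ → B₃ * ε₁ ≤ ε₀ → ε₀ ≤ a₀ →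
      ∀ V : GaugeField (F.P n) 0 (Matrix.specialUnitaryGroup (Fin 2) ℂ), PlaqSmall ε₁ V →
        ∀ Ū : GaugeField (F.P K) 0 (Matrix.specialUnitaryGroup (Fin 2) ℂ),
          Ū ∈ {U : GaugeField (F.P K) 0 (Matrix.specialUnitaryGroup (Fin 2) ℂ) | ∀ p : Plaq (F.P K) 0,
                GaugeGroup.dist1 (GaugeField.plaqHol U p) ≤ regThreshold F n K ε₀} ∩ descendTo F ℰp n K hnK.le ⁻¹' {V} ∩
            {U | ∀ b : PBond (F.P K) 0, ‖covDivT 1 (unitsField (toUField U)) b.dir b.src‖ ≤ ε₀ * ((F.L : ℝ)⁻¹) ^ (3 * (K - n))} →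
          IsMinOn (fun W : GaugeField (F.P K) 0 (Matrix.specialUnitaryGroup (Fin 2) ℂ) => wilsonAction4 W)
            ({U : GaugeField (F.P K) 0 (Matrix.specialUnitaryGroup (Fin 2) ℂ) | ∀ p : Plaq (F.P K) 0,
                GaugeGroup.dist1 (GaugeField.plaqHol U p) ≤ regThreshold F n K ε₀} ∩ descendTo F ℰp n K hnK.le ⁻¹' {V} ∩
              {U | ∀ b : PBond (F.P K) 0, ‖covDivT 1 (unitsField (toUField U)) b.dir b.src‖ ≤ ε₀ * ((F.L : ℝ)⁻¹) ^ (3 * (K - n))}) Ū →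
          RegPr F n K ε₀ Ū) :
    MinSixAttainedAt L a₀ a₁ B₃ := by
  intro F hF n K hnK ε₁ ε₀ hε₁ hε₁a hBε hε₀ V hV
  subst hF
  obtain ⟨Ū, hŪ, hmin⟩ :=
    exists_isMinOn_closedRegFibre F hnK.le ha₀ hA3 hA2 hε₀ V (hne F rfl n K hnK ε₁ ε₀ hε₁ hε₁a hBε hε₀ V hV)
  exact ⟨Ū, isMinOn_regFibrePr_of_interior F hnK.le hmin hŪ.1.2 (hint F rfl n K hnK ε₁ ε₀ hε₁ hε₁a hBε hε₀ V hV Ū hŪ hmin)⟩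

end Sockets

end Summit.QuantumFields.YangMills.Theorems.Prop7ClosedFibreMinimiser

end
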